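import Summits.NavierStokesRegularity.NavierStokesRegularity.Theses.QuantisedSymmetry
import Summits.NavierStokesRegularity.NavierStokesRegularity.Theses.Blowup
import Summits.NavierStokesRegularity.NavierStokesRegularity.Theses.DssFarFieldSlaving
import Summits.NavierStokesRegularity.NavierStokesRegularity.Theses.AncientHullSteering
import Summits.NavierStokesRegularity.NavierStokesRegularity.Theorems.QuantisedSymmetryPolyhedralTruncationBridge
import Summits.NavierStokesRegularity.NavierStokesRegularity.Theorems.QuantisedSymmetryPolyhedralDssProfileExistsDominatesBlowupProfile
import Summits.NavierStokesRegularity.NavierStokesRegularity.Theorems.QuantisedSymmetryLiouvilleKillsProfile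
import Summits.NavierStokesRegularity.NavierStokesRegularity.Theorems.DssFarFieldSlavingDssTruncationBridge
import HarnessLib

/-!
# Strategist sketch s15-g3 (family `s`, independent census) — crux `PolyhedralDssProfileExists`
# (X⁻, stmt-NavierStokesRegularity-1404) of route `QuantisedSymmetry`

Typed companion of `STRATEGY-CENSUS-s15.md` (s15-g3). It records, BY ITEM NAME and with no `sorry`,
the implication web behind the verdict "no strategy short of the summit":

* `crux_decides`      : X⁻ ⊢ ¬ NavierStokesRegularity (the two other binders of `closes` are proved);
* `w1_of_crux`, `w1_decides` : the strictly weaker, sector-free intermediate W1 =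
  `Blowup.BlowupTypeIDssProfile` (stmt-0155) is implied by X⁻ and ALSO decides the summit alone;
* `w4_of_crux`, `selfExcited_of_w4`, `w4_decides_with_bridge` : the strictly weaker NON-DSS
  intermediate W4' = ¬ `PolyhedralTypeILiouville` (negated kill switch stmt-1405) is implied by X⁻,
  implies the sister crux `AncientHullSteering.SelfExcitedTypeIProfile` (stmt-20186), and closes the
  summit only together with the OPEN sector-free rung `AncientHullSteering.AncientTruncationBridge`
  (stmt-20185).

No statement of any route is asserted; nothing here is a registered line.
-/

set_option linter.dupNamespace false

namespace Summit.NavierStokesRegularity.NavierStokesRegularity.Cruxes.PolyhedralDssProfileExists.StrategistS15g3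

open MeasureTheory
open Summit.NavierStokesRegularity.NavierStokesRegularity
open Summit.NavierStokesRegularity.NavierStokesRegularity.Theses

/-- The crux, by name. -/
abbrev X : Prop := QuantisedSymmetry.PolyhedralDssProfileExists

/-- FRAME. X⁻ alone decides the summit: `closes hX hB hU` with `hB`, `hU` the landed proofs. -/
theorem crux_decides (hX : X) : ¬ _root_.NavierStokesRegularity :=
  QuantisedSymmetry.closes hX Theorems.quantisedSymmetry_polyhedralTruncationBridge_proof
    QuantisedSymmetry.ClayUniqueness_holds

/-- W1 (strictly weaker, sector-free): X⁻ ⇒ `Blowup.BlowupTypeIDssProfile` (stmt-0155), landed stub. -/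
theorem w1_of_crux (hX : X) : Blowup.BlowupTypeIDssProfile :=
  Theorems.PolyhedralDssProfileExists.PolyhedralCell.stub_dominatesBlowupProfile hX

/-- The two copies of W1 in the tree are syntactically the same proposition. -/
theorem w1_iff : Blowup.BlowupTypeIDssProfile ↔ DssFarFieldSlaving.BlowupTypeIDssProfile := Iff.rfl

/-- W1 alone decides the summit (sector-free truncation bridge `dssTruncationBridge_proof` + route
`DssFarFieldSlaving`'s deciding theorem). Hence replacing X⁻ by W1 is a re-glue onto a sister crux,
not a strategy short of the summit. -/
theorem w1_decides (hW : Blowup.BlowupTypeIDssProfile) : ¬ _root_.NavierStokesRegularity :=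
  DssFarFieldSlaving.closes Theorems.dssTruncationBridge_proof (w1_iff.mp hW)

/-- W4' (strictly weaker, non-DSS): negation of the route's kill switch `PolyhedralTypeILiouville`
(stmt-1405): some irreducible finite rotation group admits a nontrivial bounded ancient mild solution
with Type-I decay which is equivariant — no discrete self-similarity asked. -/
def W4 : Prop := ¬ QuantisedSymmetry.PolyhedralTypeILiouville

/-- X⁻ ⇒ W4' : contrapositive of the landed `LiouvilleKillsProfile` (stmt-1408). -/
theorem w4_of_crux (hX : X) : W4 := fun hL =>
  Theorems.quantisedSymmetry_liouvilleKillsProfile_proof hL hX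

/-- W4' ⇒ the sister crux `AncientHullSteering.SelfExcitedTypeIProfile` (stmt-20186): forget `G`. -/
theorem selfExcited_of_w4 (hW : W4) : AncientHullSteering.SelfExcitedTypeIProfile := by
  intro hall
  apply hW
  intro G _hfin _hdet _hirr u hanc hmeas hdec _heqv
  exact hall u hanc hmeas hdec

/-- W4' closes the summit only together with the OPEN sector-free rung
`AncientHullSteering.AncientTruncationBridge` (stmt-20185). -/
theorem w4_decides_with_bridge (hR : AncientHullSteering.AncientTruncationBridge) (hW : W4) :
    ¬ _root_.NavierStokesRegularity :=
  AncientHullSteering.closes hR (selfExcited_of_w4 hW)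

end Summit.NavierStokesRegularity.NavierStokesRegularity.Cruxes.PolyhedralDssProfileExists.StrategistS15g3
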